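import Literature.MathematicalPhysics.QuantumFieldTheory.MagnenRivasseauSeneor1993.MRS93ParityVanishing
import Literature.MathematicalPhysics.QuantumFieldTheory.MagnenRivasseauSeneor1993.MRS93GaussianReferenceMeasures
import Literature.MathematicalPhysics.QuantumFieldTheory.MagnenRivasseauSeneor1993.MRS93AxialGaussianMeasure
import HarnessLib

/-!
# Magnen–Rivasseau–Sénéor (CMP 155, 1993), Sect. VII p.375 tl.20 «However by parity a single such vertex vanishes» —
# the parity rule APPLIED TO THE PAPER'S OWN GAUSSIAN REFERENCE MEASURES `dμ_{0,ρ₁}(A)`, `dμ_{0,ρ₁}(A′)dμ_{C₀,ρ₁}(A′₀)`,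
# `dν_{ρ₂}(γ)` and the true-cutoff Gaussian, as typed concretely by mrs-lit-1 (`…MRS93GaussianReferenceMeasures`)

one change of variables `A ↦ −A` on the momentum-lattice configurations; nothing here is a claim about the Yang–Mills
mass gap, about continuum YM₄ on T⁴, about Sect. VII's convergence, or about the Clay problem

**Citation header (reproduction of PUBLISHED work).** J. Magnen, V. Rivasseau, R. Sénéor, *Construction of YM₄ with an
infrared cutoff*, Commun. Math. Phys. **155** (1993) 325–383 [MagnenRivasseauSeneor1993], Sect. VII p.375 [PDF 51] tl.17–22
(«… However by parity a single such vertex vanishes. Therefore we have at least two such vertices …»), with the measures of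
(II.17)–(II.18) p.332 («dμ₀ … the Gaussian measure with propagator C₀(p)κ_{ρ₁}(p)», normalised), (II.36) p.339 («The Gaussian
measure on γ with covariance Γ_{ρ₂} is called dν_{ρ₂}(γ)»), (II.44)–(II.46) p.341–342 and (II.78) p.347. Cell pub-balaban-gaps
(YM blitz, track G3), seat mrs-lit-2 (gen 21), file 61; edition v1.1 (gen 22): §4–§5 appended, previous declarations
unchanged, one import added (`…MRS93AxialGaussianMeasure`, mrs-lit-1, for `muAxial` ∕ `axialRefModel`); companion record
`run/shared/lean/pub/pub-balaban-gaps/g3/MRS-AS-PRINTED-estimates.md`.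

**Context.** File 60 `…MRS93ParityVanishing` PROVES the parity rule abstractly (an odd functional has zero mean under any
negation-invariant measure; the diagonal of a trilinear form — the `A²∂A` vertex — is odd) and, in its edition v1.1, that every
centred Gaussian measure in Mathlib's Banach-space sense is negation-invariant. mrs-lit-1's `…MRS93GaussianReferenceMeasures`
types MRS's reference Gaussians CONCRETELY, not as Banach-space Gaussians but as laws on the product space of momentum-lattice
coordinates: `MainStatement.modeGaussian v = ⊗_m 𝒩(0, v m)` (Mathlib `Measure.infinitePi` of centred `gaussianReal`s) and
`MainStatement.gaussianFieldLaw im v = (modeGaussian v).map (realify im)` (the reality constraint `Ã(−p) = conj Ã(p)`), of which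
`muZero par ρ₁ = dμ_{0,ρ₁}(A)`, `muZeroPrime par ρ₁`, `nu par ρ₂ = dν_{ρ₂}(γ)` and `muTrueCutoff par ρ ρ₁` are instances. This
file closes the gap between the two: THOSE measures are negation-invariant, so a single cubic vertex — indeed every odd functional,
in particular every coordinate monomial of odd degree — has zero mean under each of them.

**What this file PROVES (kernel; zero `sorry`, zero named facts; nothing of mrs-lit-1's file is modified — its objects are used
by name).**
* §1 (closure properties of negation-invariance) `isNegInvariant_map_of_odd`: the image of a negation-invariant measure under a
  measurable ODD map (`f(−x) = −f(x)`) is negation-invariant; `isNegInvariant_infinitePi`: an arbitrary product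
  (`Measure.infinitePi`) of negation-invariant probability measures is negation-invariant (`Measure.infinitePi_map_pi`);
  `isNegInvariant_infinitePi_gaussianReal_zero`: so is `⊗_i 𝒩(0, v i)` for any family of variances (file 60's
  `isNegInvariant_gaussianReal_zero` coordinatewise).
* §2 (MRS's measures) `realify_neg`: realification is odd (it is linear); hence **`isNegInvariant_modeGaussian`**,
  **`isNegInvariant_gaussianFieldLaw`** (every label type, every imaginary-part flag, every variance family), and the four named
  instances **`isNegInvariant_muZero`** (`dμ_{0,ρ₁}(A)`), `isNegInvariant_muZeroPrime`, **`isNegInvariant_nu`** (`dν_{ρ₂}(γ)`),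
  `isNegInvariant_muTrueCutoff`.
* §3 (the payoff, p.375) `gmonomial_neg`: a coordinate monomial of degree `N` satisfies `Π_j (−X)(f j) = (−1)^N Π_j X(f j)`;
  **`integral_gmonomial_gaussianFieldLaw_eq_zero_of_odd`**: every coordinate monomial of ODD degree has zero mean under every
  `gaussianFieldLaw` — in particular (`integral_monomial_muZero_eq_zero_of_odd`) every odd moment `∫ Π_{j<N} A(f j) dμ_{0,ρ₁}(A)`,
  `N` odd, VANISHES; **`integral_cubic_muZero_eq_zero`** ∕ `integral_cubic_nu_eq_zero`: `∫ T(A,A,A) dμ_{0,ρ₁}(A) = 0` and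
  `∫ T(γ,γ,γ) dν_{ρ₂}(γ) = 0` for every trilinear `T` on the configurations — «by parity a single such vertex vanishes» for the
  paper's own reference measures; `integral_eq_zero_of_odd_gaussianFieldLaw` for any odd functional.
* §4 (edition v1.1, gen 22 — the AXIAL-GAUGE Gaussian of (II.18)–(II.19) p.332, «the Gaussian measure dμ_axial and propagators
  C_axial are obtained by joining to C₀ the quadratic piece ⟨A, p₀²A⟩», mrs-lit-1's `muAxial S par ρ₁` of
  `…MRS93AxialGaussianMeasure`, used by name) **`isNegInvariant_muAxial`**: `dμ_{axial,ρ₁}(A)` is invariant under `A ↦ −A` on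
  EVERY momentum window `S` (no symmetry of the window needed: it is a `gaussianFieldLaw`); hence
  `integral_eq_zero_of_odd_muAxial` (every odd functional), **`integral_monomial_muAxial_eq_zero_of_odd`** (every ODD moment
  `∫ Π_{j<N} A(f j) dμ_{axial,ρ₁}(A)`, `N` odd, vanishes — the companion of mrs-lit-1's `integral_monomial_muAxial_eq_zero_of_time`,
  which kills the monomials containing a time component), **`integral_cubic_muAxial_eq_zero`** (a single trilinear vertex has
  zero mean under `dμ_{axial,ρ₁}`).
* §5 (edition v1.1 — the consequence at the level of the pinned interface of `…MRS93MainStatementPinned`, whose Schwinger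
  functions are `S_ρ(N, f) = ∫ Π_j A(f j) d(law ρ)`, (VIII.1) p.377) **`schwinger_eq_zero_of_odd`**: for ANY carrier
  `T : PinnedTheory` whose cutoff laws are negation-invariant, every Schwinger function of ODD order vanishes at every cutoff
  `ρ`, and (**`Slim_eq_zero_of_odd`**) so does every odd-order ultraviolet-limit value `Slim N f` (a `limUnder` of the zero
  sequence — no existence hypothesis needed); instances **`gaussianRefModel_schwinger_eq_zero_of_odd`** ∕ `gaussianRefModel_Slim_eq_zero_of_odd`
  (mrs-lit-1's reference model `⟨·⟩_ρ := dμ_{0,ρ₁(ρ)}`) and **`axialRefModel_schwinger_eq_zero_of_odd`** ∕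
  `axialRefModel_Slim_eq_zero_of_odd` (its axial reference model `⟨·⟩_ρ := dμ_{axial,ρ₁(ρ)}`): the free carriers that inhabit
  the pinned interface have only EVEN-order Schwinger functions, as parity demands.

**Readings (declared).** As in file 60: «by parity» = invariance of the centred Gaussian reference measure under `A ↦ −A` +
oddness of one trilinear vertex; the vertex `A²∂A` is READ as the diagonal of a trilinear form on the configuration space (here
the momentum-lattice coordinates `Config = Mode → ℝ` of mrs-lit-1's pinned carrier; trilinearity over `ℝ` of the `x`-space vertex
`Tr ∫ A²∂A` in the Fourier coordinates is plain). The interacting measure of Sect. VII is NOT negation-invariant term by term in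
the cluster expansion beyond what the paper says; only the Gaussian reference measures are treated.

**What is NOT claimed.** The power counting (file 4), the Gaussian integration of two vertices, anything of Sect. VII's
convergence, any property of mrs-lit-1's measures beyond this symmetry. MRS work at fixed infrared cutoff; nothing here bears on
a mass gap or on Bałaban's programme.
-/

noncomputable section

open MeasureTheory ProbabilityTheory

namespace Literature.MathematicalPhysics.QuantumFieldTheory.MagnenRivasseauSeneor1993

namespace Parity

/-! ## §1 Closure properties of negation-invariance -/

section closure

/-- The image of a negation-invariant measure under a measurable ODD map is negation-invariant.
[cite: MagnenRivasseauSeneor1993, §VII p.375 tl.20 «by parity»] -/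
theorem isNegInvariant_map_of_odd {G H : Type*} [MeasurableSpace G] [MeasurableSpace H] [InvolutiveNeg G] [Neg H]
    [MeasurableNeg G] [MeasurableNeg H] (μ : Measure G) [μ.IsNegInvariant] {f : G → H} (hf : Measurable f)
    (hodd : ∀ x, f (-x) = -f x) : (μ.map f).IsNegInvariant := by
  refine ⟨?_⟩
  rw [Measure.neg_def, Measure.map_map measurable_neg hf]
  have h : (Neg.neg : H → H) ∘ f = f ∘ (Neg.neg : G → G) := by
    funext x; simp [Function.comp, hodd]
  rw [h, ← Measure.map_map hf measurable_neg, Measure.map_neg_eq_self]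

/-- An arbitrary product of negation-invariant probability measures is negation-invariant (`Measure.infinitePi_map_pi`).
[cite: MagnenRivasseauSeneor1993, §VII p.375 tl.20 «by parity»] -/
theorem isNegInvariant_infinitePi {ι : Type*} {X : ι → Type*} [∀ i, MeasurableSpace (X i)] [∀ i, Neg (X i)]
    [∀ i, MeasurableNeg (X i)] (μ : (i : ι) → Measure (X i)) [∀ i, IsProbabilityMeasure (μ i)]
    [∀ i, (μ i).IsNegInvariant] : (Measure.infinitePi μ).IsNegInvariant := by
  refine ⟨?_⟩
  rw [Measure.neg_def, show (Neg.neg : ((i : ι) → X i) → (i : ι) → X i) = fun x i => -(x i) from rfl,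
    Measure.infinitePi_map_pi μ (fun i => measurable_neg)]
  congr 1
  funext i
  exact Measure.map_neg_eq_self (μ i)

/-- The product `⊗_i 𝒩(0, v i)` of centred one-dimensional Gaussians is negation-invariant, for any family of variances.
[cite: MagnenRivasseauSeneor1993, §VII p.375 tl.20 «by parity»] -/
theorem isNegInvariant_infinitePi_gaussianReal_zero {ι : Type*} (v : ι → NNReal) :
    (Measure.infinitePi fun i => gaussianReal 0 (v i)).IsNegInvariant := by
  haveI : ∀ i, (gaussianReal 0 (v i)).IsNegInvariant := fun i => isNegInvariant_gaussianReal_zero (v i)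
  exact isNegInvariant_infinitePi _

end closure

/-! ## §2 MRS's Gaussian reference measures are negation-invariant -/

section mrs

open MainStatement

variable {L : Type*}

/-- Realification is odd (it is linear): `realify im (−X) = −realify im X`.
[cite: MagnenRivasseauSeneor1993, §II.A p.328 tl.12–17] -/
theorem realify_neg (im : L → Bool) (X : Momentum × L → ℝ) : realify im (-X) = -realify im X := by
  funext m
  simp [realify, mul_neg]

/-- `⊗_m 𝒩(0, v m)` on the momentum-lattice coordinates is negation-invariant.
[cite: MagnenRivasseauSeneor1993, (II.17)–(II.18) p.332; §VII p.375 tl.20] -/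
theorem isNegInvariant_modeGaussian (v : Momentum × L → NNReal) : (modeGaussian v).IsNegInvariant := by
  unfold modeGaussian
  exact isNegInvariant_infinitePi_gaussianReal_zero v

/-- **The real Gaussian field law `gaussianFieldLaw im v` (independent centred modes, realified) is invariant under `A ↦ −A`**,
for every label type, flag and variance family. [cite: MagnenRivasseauSeneor1993, (II.17)–(II.18) p.332; §VII p.375 tl.20] -/
theorem isNegInvariant_gaussianFieldLaw (im : L → Bool) (v : Momentum × L → NNReal) :
    (gaussianFieldLaw im v).IsNegInvariant := by
  haveI := isNegInvariant_modeGaussian v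
  unfold gaussianFieldLaw
  exact isNegInvariant_map_of_odd _ (measurable_realify im) (realify_neg im)

/-- **`dμ_{0,ρ₁}(A)` is invariant under `A ↦ −A`.** [cite: MagnenRivasseauSeneor1993, (II.18) p.332; §VII p.375 tl.20] -/
theorem isNegInvariant_muZero (par : Parameters) (ρ₁ : ℕ) : (muZero par ρ₁).IsNegInvariant := by
  unfold muZero; exact isNegInvariant_gaussianFieldLaw _ _

/-- `dμ_{0,ρ₁}(A′)dμ_{C₀,ρ₁}(A′₀)` is invariant under `A′ ↦ −A′`. [cite: MagnenRivasseauSeneor1993, (II.44)–(II.46) p.341–342; §VII p.375 tl.20] -/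
theorem isNegInvariant_muZeroPrime (par : Parameters) (ρ₁ : ℕ) : (muZeroPrime par ρ₁).IsNegInvariant := by
  unfold muZeroPrime; exact isNegInvariant_gaussianFieldLaw _ _

/-- **`dν_{ρ₂}(γ)` is invariant under `γ ↦ −γ`.** [cite: MagnenRivasseauSeneor1993, (II.36) p.339; §VII p.375 tl.20] -/
theorem isNegInvariant_nu (par : Parameters) (ρ₂ : ℕ) : (nu par ρ₂).IsNegInvariant := by
  unfold nu; exact isNegInvariant_gaussianFieldLaw _ _

/-- The true-cutoff reference Gaussian of (II.78) is invariant under `A′ ↦ −A′`.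
[cite: MagnenRivasseauSeneor1993, (II.78) p.347; §VII p.375 tl.20] -/
theorem isNegInvariant_muTrueCutoff (par : Parameters) (ρ ρ₁ : ℕ) : (muTrueCutoff par ρ ρ₁).IsNegInvariant := by
  unfold muTrueCutoff; exact isNegInvariant_gaussianFieldLaw _ _

end mrs

/-! ## §3 «by parity a single such vertex vanishes» for the paper's own reference measures -/

section payoff

open MainStatement

variable {L : Type*}

/-- A coordinate monomial of degree `N` picks up `(−1)^N` under `X ↦ −X`.
[cite: MagnenRivasseauSeneor1993, (VIII.1) p.377; §VII p.375 tl.20] -/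
theorem gmonomial_neg {N : ℕ} (f : Fin N → Momentum × L) (X : Momentum × L → ℝ) :
    gmonomial f (-X) = (-1) ^ N * gmonomial f X := by
  unfold gmonomial
  simp only [Pi.neg_apply]
  rw [Finset.prod_neg, Finset.card_univ, Fintype.card_fin]

/-- Every ODD functional has zero mean under every real Gaussian field law `gaussianFieldLaw im v`.
[cite: MagnenRivasseauSeneor1993, §VII p.375 tl.20 «by parity a single such vertex vanishes»] -/
theorem integral_eq_zero_of_odd_gaussianFieldLaw (im : L → Bool) (v : Momentum × L → NNReal)
    {F : (Momentum × L → ℝ) → ℝ} (hF : ∀ X, F (-X) = -F X) : ∫ X, F X ∂(gaussianFieldLaw im v) = 0 := by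
  haveI := isNegInvariant_gaussianFieldLaw im v
  exact integral_eq_zero_of_odd _ hF

/-- **Odd moments vanish**: a coordinate monomial of ODD degree has zero mean under every `gaussianFieldLaw im v`.
[cite: MagnenRivasseauSeneor1993, §VII p.375 tl.20; (VIII.1) p.377] -/
theorem integral_gmonomial_gaussianFieldLaw_eq_zero_of_odd (im : L → Bool) (v : Momentum × L → NNReal) {N : ℕ}
    (f : Fin N → Momentum × L) (hN : Odd N) : ∫ X, gmonomial f X ∂(gaussianFieldLaw im v) = 0 := by
  refine integral_eq_zero_of_odd_gaussianFieldLaw im v (fun X => ?_)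
  rw [gmonomial_neg, hN.neg_one_pow, neg_one_mul]

/-- **Odd moments of `dμ_{0,ρ₁}(A)` vanish**: `∫ Π_{j<N} A(f j) dμ_{0,ρ₁}(A) = 0` for `N` odd (the pinned carrier's `monomial`).
[cite: MagnenRivasseauSeneor1993, (II.18) p.332; §VII p.375 tl.20] -/
theorem integral_monomial_muZero_eq_zero_of_odd (par : Parameters) (ρ₁ : ℕ) {N : ℕ} (f : Fin N → Mode) (hN : Odd N) :
    ∫ A, monomial f A ∂(muZero par ρ₁) = 0 := by
  unfold muZero
  exact integral_gmonomial_gaussianFieldLaw_eq_zero_of_odd modeIm _ f hN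

/-- **p.375 «by parity a single such vertex vanishes» for `dμ_{0,ρ₁}`**: `∫ T(A,A,A) dμ_{0,ρ₁}(A) = 0` for every trilinear
vertex `T` on the configurations. [cite: MagnenRivasseauSeneor1993, §VII p.375 tl.17–20; (II.18) p.332] -/
theorem integral_cubic_muZero_eq_zero (par : Parameters) (ρ₁ : ℕ) (T : Config →ₗ[ℝ] Config →ₗ[ℝ] Config →ₗ[ℝ] ℝ) :
    ∫ A, T A A A ∂(muZero par ρ₁) = 0 := by
  haveI := isNegInvariant_muZero par ρ₁
  exact integral_cubic_eq_zero _ T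

/-- The same for the true-cutoff reference Gaussian of (II.78). [cite: MagnenRivasseauSeneor1993, §VII p.375 tl.17–20; (II.78) p.347] -/
theorem integral_cubic_muTrueCutoff_eq_zero (par : Parameters) (ρ ρ₁ : ℕ)
    (T : Config →ₗ[ℝ] Config →ₗ[ℝ] Config →ₗ[ℝ] ℝ) : ∫ A, T A A A ∂(muTrueCutoff par ρ ρ₁) = 0 := by
  haveI := isNegInvariant_muTrueCutoff par ρ ρ₁
  exact integral_cubic_eq_zero _ T

/-- And for the ghost-field Gaussian `dν_{ρ₂}(γ)`: `∫ T(γ,γ,γ) dν_{ρ₂}(γ) = 0` for every trilinear `T`.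
[cite: MagnenRivasseauSeneor1993, §VII p.375 tl.17–20; (II.36) p.339] -/
theorem integral_cubic_nu_eq_zero (par : Parameters) (ρ₂ : ℕ)
    (T : GhostConfig →ₗ[ℝ] GhostConfig →ₗ[ℝ] GhostConfig →ₗ[ℝ] ℝ) : ∫ γ, T γ γ γ ∂(nu par ρ₂) = 0 := by
  haveI := isNegInvariant_nu par ρ₂
  exact integral_cubic_eq_zero _ T

end payoff

/-! ## §4 (edition v1.1) The axial-gauge Gaussian `dμ_{axial,ρ₁}` of (II.18)–(II.19) is negation-invariant; its odd moments vanish -/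

section axial

open MainStatement

/-- **`dμ_{axial,ρ₁}(A)` is invariant under `A ↦ −A`**, on every momentum window `S` («the Gaussian measure dμ_axial …
obtained by joining to C₀ the quadratic piece ⟨A, p₀²A⟩» is again a real Gaussian field law with centred independent modes).
[cite: MagnenRivasseauSeneor1993, (II.18)–(II.19) p.332 tl.18–21; §VII p.375 tl.20 «by parity»] -/
theorem isNegInvariant_muAxial (S : Finset Momentum) (par : Parameters) (ρ₁ : ℕ) : (muAxial S par ρ₁).IsNegInvariant := by
  unfold muAxial; exact isNegInvariant_gaussianFieldLaw _ _

/-- Every ODD functional has zero mean under `dμ_{axial,ρ₁}`. [cite: MagnenRivasseauSeneor1993, §VII p.375 tl.20; (II.18) p.332] -/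
theorem integral_eq_zero_of_odd_muAxial (S : Finset Momentum) (par : Parameters) (ρ₁ : ℕ) {F : Config → ℝ}
    (hF : ∀ A, F (-A) = -F A) : ∫ A, F A ∂(muAxial S par ρ₁) = 0 := by
  haveI := isNegInvariant_muAxial S par ρ₁
  exact integral_eq_zero_of_odd _ hF

/-- **Odd moments of `dμ_{axial,ρ₁}(A)` vanish**: `∫ Π_{j<N} A(f j) dμ_{axial,ρ₁}(A) = 0` for `N` odd, on every window (the
companion of `integral_monomial_muAxial_eq_zero_of_time`). [cite: MagnenRivasseauSeneor1993, (II.18)–(II.19) p.332; §VII p.375 tl.20] -/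
theorem integral_monomial_muAxial_eq_zero_of_odd (S : Finset Momentum) (par : Parameters) (ρ₁ : ℕ) {N : ℕ}
    (f : Fin N → Mode) (hN : Odd N) : ∫ A, monomial f A ∂(muAxial S par ρ₁) = 0 := by
  unfold muAxial
  exact integral_gmonomial_gaussianFieldLaw_eq_zero_of_odd modeIm _ f hN

/-- **p.375 «by parity a single such vertex vanishes» for `dμ_{axial,ρ₁}`**: `∫ T(A,A,A) dμ_{axial,ρ₁}(A) = 0` for every
trilinear vertex `T` on the configurations. [cite: MagnenRivasseauSeneor1993, §VII p.375 tl.17–20; (II.18)–(II.19) p.332] -/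
theorem integral_cubic_muAxial_eq_zero (S : Finset Momentum) (par : Parameters) (ρ₁ : ℕ)
    (T : Config →ₗ[ℝ] Config →ₗ[ℝ] Config →ₗ[ℝ] ℝ) : ∫ A, T A A A ∂(muAxial S par ρ₁) = 0 := by
  haveI := isNegInvariant_muAxial S par ρ₁
  exact integral_cubic_eq_zero _ T

end axial

/-! ## §5 (edition v1.1) Consequence for the pinned interface: a negation-invariant carrier has only EVEN-order Schwinger functions -/

section pinned

open MainStatement Filter Topology

/-- **For any carrier of the pinned interface whose cutoff laws are invariant under `A ↦ −A`, every Schwinger function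
`S_ρ(N, f) = ∫ Π_j A(f j) d(law ρ)` of ODD order `N` vanishes**, at every cutoff `ρ`.
[cite: MagnenRivasseauSeneor1993, §VII p.375 tl.20 «by parity»; (VIII.1) p.377] -/
theorem schwinger_eq_zero_of_odd (T : PinnedTheory) (hT : ∀ ρ, (T.law ρ).IsNegInvariant) (ρ : ℕ) {N : ℕ}
    (f : Fin N → Mode) (hN : Odd N) : T.schwinger ρ N f = 0 := by
  haveI := hT ρ
  unfold PinnedTheory.schwinger
  refine integral_eq_zero_of_odd _ (fun A => ?_)
  rw [monomial_eq_gmonomial, gmonomial_neg, hN.neg_one_pow, neg_one_mul]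

/-- Hence every ultraviolet-limit value `Slim N f` of ODD order of such a carrier is `0` (the `limUnder` of the identically
zero sequence; no existence hypothesis on the limit is needed). [cite: MagnenRivasseauSeneor1993, p.327 tl.39–41; §VII p.375 tl.20] -/
theorem Slim_eq_zero_of_odd (T : PinnedTheory) (hT : ∀ ρ, (T.law ρ).IsNegInvariant) {N : ℕ} (f : Fin N → Mode)
    (hN : Odd N) : T.toAxialTheory.Slim N f = 0 := by
  unfold AxialTheory.Slim
  have h : (fun ρ => T.toAxialTheory.S ρ N f) = fun _ => (0 : ℝ) := by
    funext ρ
    rw [PinnedTheory.toAxialTheory_S]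
    exact schwinger_eq_zero_of_odd T hT ρ f hN
  rw [h]
  exact tendsto_const_nhds.limUnder_eq

/-- **mrs-lit-1's Gaussian reference model `⟨·⟩_ρ := dμ_{0,ρ₁(ρ)}(A)` has vanishing Schwinger functions of every ODD order.**
[cite: MagnenRivasseauSeneor1993, (II.18) p.332; §VII p.375 tl.20; (VIII.1) p.377] -/
theorem gaussianRefModel_schwinger_eq_zero_of_odd (par : Parameters) (WTest : ℕ → Type)
    (wardData : (N : ℕ) → WTest N → WardData) (E : (N : ℕ) → WTest N → ℝ) (ρ : ℕ) {N : ℕ} (f : Fin N → Mode)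
    (hN : Odd N) : (gaussianRefModel par WTest wardData E).schwinger ρ N f = 0 :=
  schwinger_eq_zero_of_odd _ (fun ρ => isNegInvariant_muZero par (par.ρ₁ ρ)) ρ f hN

/-- … and so do its odd-order ultraviolet-limit values. [cite: MagnenRivasseauSeneor1993, p.327 tl.39–41; §VII p.375 tl.20] -/
theorem gaussianRefModel_Slim_eq_zero_of_odd (par : Parameters) (WTest : ℕ → Type)
    (wardData : (N : ℕ) → WTest N → WardData) (E : (N : ℕ) → WTest N → ℝ) {N : ℕ} (f : Fin N → Mode) (hN : Odd N) :
    (gaussianRefModel par WTest wardData E).toAxialTheory.Slim N f = 0 :=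
  Slim_eq_zero_of_odd _ (fun ρ => isNegInvariant_muZero par (par.ρ₁ ρ)) f hN

/-- **The axial reference model `⟨·⟩_ρ := dμ_{axial,ρ₁(ρ)}(A)` (on the canonical window of `ρ₁(ρ)`) has vanishing Schwinger
functions of every ODD order.** [cite: MagnenRivasseauSeneor1993, (II.18)–(II.19) p.332; §VII p.375 tl.20; (VIII.1) p.377] -/
theorem axialRefModel_schwinger_eq_zero_of_odd (par : Parameters) (WTest : ℕ → Type)
    (wardData : (N : ℕ) → WTest N → WardData) (E : (N : ℕ) → WTest N → ℝ) (ρ : ℕ) {N : ℕ} (f : Fin N → Mode)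
    (hN : Odd N) : (axialRefModel par WTest wardData E).schwinger ρ N f = 0 :=
  schwinger_eq_zero_of_odd _ (fun ρ => isNegInvariant_muAxial _ par (par.ρ₁ ρ)) ρ f hN

/-- … and so do its odd-order ultraviolet-limit values. [cite: MagnenRivasseauSeneor1993, p.327 tl.39–41; §VII p.375 tl.20] -/
theorem axialRefModel_Slim_eq_zero_of_odd (par : Parameters) (WTest : ℕ → Type)
    (wardData : (N : ℕ) → WTest N → WardData) (E : (N : ℕ) → WTest N → ℝ) {N : ℕ} (f : Fin N → Mode) (hN : Odd N) :
    (axialRefModel par WTest wardData E).toAxialTheory.Slim N f = 0 :=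
  Slim_eq_zero_of_odd _ (fun ρ => isNegInvariant_muAxial _ par (par.ρ₁ ρ)) f hN

end pinned

end Parity

end Literature.MathematicalPhysics.QuantumFieldTheory.MagnenRivasseauSeneor1993
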